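import Summits.BirchSwinnertonDyer.BirchSwinnertonDyer.Theorems.ManinLocalTwoThreeHeckeCharacterThirtySix
import Summits.BirchSwinnertonDyer.BirchSwinnertonDyer.Theorems.ManinLocalTwoThreeNonVacuityThirtySix
import Literature.NumberTheory.EllipticCurves.SexticTwistFiveReciprocity
import HarnessLib

/-!
# `36a1 : y² = x³ + 1` is modular by HECKE'S THETA SERIES of `ℚ(ω)` mod `2λ`, FACT-FREE; `η(6τ)⁴` is its newform;
# the `X₀(36)`-domain of C2/C3 is inhabited UNCONDITIONALLY (and every datum there has `|c| = 1`)
(route `ManinLocalTwoThree`, cruxes C2 `ManinOddAtFour` stmt-22967 / C3 `ManinPrimeToThreeAtNine` stmt-22968 at `N = 36 = 4·9`;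
cell bsd-f2-manin, prover seat p2 gen 26; sequel of `HeckeCharacterThirtySix`; level-`36` twin of `HeckeThetaTwentySeven` §5–§6)

* §1 the inert prime `(2)` of `ℤ[ω]` (`𝔽₄`), and ★ **cubic reciprocity for the rational prime `2`** in Artin-symbol form:
  `ν₂(𝔞) = e(χ_{(2)}(ϖ_𝔞))` for `𝔞` prime to `6` (`psi_two_eq_cubicResidueSymbol_primGen`; Ireland–Rosen Ch. 9 §4 with `q = 2`:
  `χ_𝔭(2) = χ_{(2)}(J(χ_𝔭,χ_𝔭)) = χ_{(2)}(−ϖ_𝔭)`), hence `ν₄(𝔞) = e(χ_{(2)}(ϖ_𝔞))²`.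
* §2 ★ **the two primary generators**: for `𝔞` prime to `6` with `ϖ ≡ 1 (mod 3)` its primary generator, the generator `≡ 1 (mod 2λ)`
  is `ϖ′ = χ_{(2)}(ϖ)² · ϖ` (`primarize_primGen`: `χ_{(2)}(ϖ) ≡ ϖ (mod 2)` and `ϖ³ ≡ 1 (mod 2)`; `χ² ≡ 1 ≡ ϖ (mod λ)`).
* §3 hence the ray-class coefficient of the mod-`2λ` Größencharakter IS Ireland–Rosen's weight of `y² = x³ + 1`:
  `rayClassCoeff (2λ) ψ 𝔞 = ν₄(𝔞) e(ϖ_𝔞)` (`rayClassCoeff_psi36`), and **`aₙ(g) = aₙ(36a1)`** for the theta series `g` of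
  `HeckeCharacterThirtySix.exists_heckeTheta_thirtySix` (tree `SexticTwist.lFunction_eq_jacobiSym_mul_sum` at `k = 1`).
* §4 **`existsNewform_thirtySixA1 : ∃ g ∈ S₂(Γ₀(36)), IsNewformOf 36a1 g`** FACT-FREE; with `NewformThirtySix` (the only newform of
  level `36` is `η(6τ)⁴`): **`aₙ(η(6τ)⁴) = aₙ(y² = x³ + 1)` for all `n`** and `IsNewformOf 36a1 (η(6τ)⁴)`, kernel-checked with no printed input.
* §5 **THE WITNESS (UNCONDITIONAL): a lattice-optimal `X₀(36)`-datum on a global minimal model in the class `36a` exists**, the C2- and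
  C3-binder blocks at `N = 36` are inhabited, and (with `LigozatIdentitiesThirtySix`) every such datum has `|c| = 1`, `2 ∤ c`, `3 ∤ c` —
  the first level in BOTH crux domains where both the domain and the conclusion are fact-free theorems.

HONEST FRAMING: everything here is unconditional (standard axioms).  Nothing here proves C2, C3 (which quantify over ALL levels),
Manin's conjecture or BSD; the items stay OPEN as filed.  No definition, no named fact, no sorry.
[cite: Hecke1926Modulfunktionen] [cite: IrelandRosen1990, Ch. 9 §3–§4, Ch. 18 §7] [cite: Koehler2011, §1] [cite: CremonaAlgorithms1997, Table 1 (36a1), Table 3]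
[cite: EdixhovenManin1991, Prop. 2]
-/

set_option autoImplicit false
-- lint-debt: the directory name repeats the summit name (sibling precedent `ManinLocalTwoThreeHeckeThetaTwentySeven.lean`)
set_option linter.dupNamespace false

noncomputable section

open scoped Classical ComplexConjugate MatrixGroups UpperHalfPlane ModularForm Real
open Complex NumberField IsDedekindDomain Finset CongruenceSubgroup
open Literature.NumberTheory.NumberFields Literature.NumberTheory.NumberFields.K3
open Literature.NumberTheory.GaloisRepresentations
open Literature.NumberTheory.LFunctions Literature.NumberTheory.LFunctions.NumberField
open Literature.NumberTheory.LFunctions.EisensteinGrossen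
open Literature.NumberTheory.EllipticCurves Literature.NumberTheory.EllipticCurves.ModularForms
open Literature.NumberTheory.EllipticCurves.SexticTwist
open Literature.NumberTheory.Automorphic

namespace Summit.BirchSwinnertonDyer.BirchSwinnertonDyer.Theorems.ManinLocalTwoThree.HeckeThetaThirtySix

open HeckeCharacterThirtySix

/-! ## §1 The inert prime `(2)` and cubic reciprocity for the rational prime `2` -/

/-- `(2)` is a prime of `ℤ[ω]` (`2 ≡ 2 (mod 3)` is inert). [cite: IrelandRosen1990, Ch. 9 §1 Prop. 9.1.4] -/
theorem exists_two_mem : ∃ v : HeightOneSpectrum (𝓞 K3), ((2 : ℤ) : 𝓞 K3) ∈ v.asIdeal := by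
  have hp : Prime ((2 : ℤ) : 𝓞 K3) := prime_natCast_of_mod_three_eq_two Nat.prime_two (by norm_num)
  exact ⟨⟨Ideal.span {((2 : ℤ) : 𝓞 K3)}, (Ideal.span_singleton_prime hp.ne_zero).mpr hp,
    by rw [Ne, Ideal.span_singleton_eq_bot]; exact hp.ne_zero⟩, Ideal.mem_span_singleton_self _⟩

/-- The prime `(2)` of `𝓞 K3` has residue field of order `4`. [cite: IrelandRosen1990, Ch. 9 §1 Prop. 9.1.4] -/
theorem residueCard_eq_of_two_mem {v : HeightOneSpectrum (𝓞 K3)} (hv : ((2 : ℤ) : 𝓞 K3) ∈ v.asIdeal) :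
    v.residueCard = 2 ^ 2 := by
  have h := asIdeal_eq_of_mod_three_eq_two Nat.prime_two (by norm_num) v hv
  show Ideal.absNorm v.asIdeal = 2 ^ 2
  rw [h]; exact EisensteinGrossen.absNorm_span_natCast 2

/-- `3 ∉ (2)` in `𝓞 K3`. [folklore] -/
theorem three_not_mem_of_two_mem {v : HeightOneSpectrum (𝓞 K3)} (hv : ((2 : ℤ) : 𝓞 K3) ∈ v.asIdeal) :
    (3 : 𝓞 K3) ∉ v.asIdeal := by
  have h3 := intCast_not_mem Nat.prime_two hv (n := 3) (by norm_num)
  push_cast at h3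
  exact h3

/-- ★ **Cubic reciprocity for the rational prime `2`, Artin-symbol form: `ν₂(𝔞) = e((ϖ_𝔞 / 2)₃)`** for every ideal `𝔞` of `ℤ[ω]` prime to
`6`, `ϖ_𝔞 ≡ 1 (3)` its primary generator (at a prime `𝔭 ∤ 6`: `ν₂(𝔭) = e(χ_𝔭(2))` and `χ_𝔭(2) = χ_{(2)}(J(χ_𝔭, χ_𝔭)) = χ_{(2)}(−ϖ_𝔭) = χ_{(2)}(ϖ_𝔭)`;
both sides multiplicative).  Port of the tree's `psi_five_eq_cubicResidueSymbol_primGen` to `q = 2`.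
[cite: IrelandRosen1990, Ch. 9 §3 Theorem 1 and §4 (proof, case `π₁ = q ≡ 2 (3)`)] -/
theorem psi_two_eq_cubicResidueSymbol_primGen {v₂ : HeightOneSpectrum (𝓞 K3)} (hv : ((2 : ℤ) : 𝓞 K3) ∈ v₂.asIdeal)
    (I : Ideal (𝓞 K3)) (h : Adm ((2 : ℤ) : 𝓞 K3) I) :
    ((psi ((2 : ℤ) : 𝓞 K3) I : ℂˣ) : ℂ) = embC ((cubicResidueSymbol v₂ (Ideal.Quotient.mk v₂.asIdeal (primGen I)) : 𝓞 K3) : K3) := by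
  have h3₂ := three_not_mem_of_two_mem hv
  have hv2 : ((2 : ℕ) : 𝓞 K3) ∈ v₂.asIdeal := by have h := hv; rw [Int.cast_ofNat] at h; rwa [Nat.cast_ofNat]
  have hcard := residueCard_eq_of_two_mem hv
  induction I using UniqueFactorizationMonoid.induction_on_prime with
  | h₁ => exact absurd rfl h.1
  | h₂ J hJ =>
    rw [Ideal.isUnit_iff.mp hJ, psi_top, primGen_top, map_one, cubicResidueSymbol_one EisensteinGrossen.hζ h3₂]
    simp
  | h₃ J P hJ0 hP ih =>
    obtain ⟨hP', hJ'⟩ := (adm_mul_iff ((2 : ℤ) : 𝓞 K3)).mp h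
    have hPne : P ≠ ⊥ := hP.ne_zero
    set v : HeightOneSpectrum (𝓞 K3) := ⟨P, Ideal.isPrime_of_prime hP, hPne⟩ with hvdef
    have hvP : v.asIdeal = P := rfl
    rw [← hvP] at hP' ⊢
    obtain ⟨h3, h2⟩ := not_mem_of_adm hP'
    have h2' : ((2 : ℕ) : 𝓞 K3) ∉ v.asIdeal := by have h := h2; rw [Int.cast_ofNat] at h; rwa [Nat.cast_ofNat]
    have hrec := cubicResidueSymbol_natCast_eq_cubicResidueSymbol_cubicJacobiSum EisensteinGrossen.hζ (q := 2) (by norm_num)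
      hv2 hcard h3 h2'
    have hJ : cubicJacobiSum EisensteinGrossen.hζ v h3 = -primGen v.asIdeal :=
      cubicJacobiSum_eq_neg_of_span_eq EisensteinGrossen.hζ v h3 (span_primGen hP'.coprime_three) (primGen_sub_one_mem hP'.coprime_three)
    have hcast : (Ideal.Quotient.mk v.asIdeal ((2 : ℤ) : 𝓞 K3)) = ((2 : ℕ) : 𝓞 K3 ⧸ v.asIdeal) := by
      rw [map_intCast]; rfl
    have hneg : Ideal.Quotient.mk v₂.asIdeal (-primGen v.asIdeal) = (-1) * Ideal.Quotient.mk v₂.asIdeal (primGen v.asIdeal) := by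
      rw [map_neg (Ideal.Quotient.mk v₂.asIdeal) (primGen v.asIdeal), neg_one_mul]
    have hprime : ((psi ((2 : ℤ) : 𝓞 K3) v.asIdeal : ℂˣ) : ℂ) =
        embC ((cubicResidueSymbol v₂ (Ideal.Quotient.mk v₂.asIdeal (primGen v.asIdeal)) : 𝓞 K3) : K3) := by
      rw [psi_asIdeal_eq _ v h2 h3, hcast, hrec, hJ, hneg, cubicResidueSymbol_mul EisensteinGrossen.hζ,
        cubicResidueSymbol_neg_one h3₂, one_mul]
    rw [EisensteinGrossen.psi_mul _ hPne hJ0, Units.val_mul, ih hJ', primGen_mul hP'.coprime_three hJ'.coprime_three, map_mul,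
      cubicResidueSymbol_mul EisensteinGrossen.hζ, hvP, hprime]
    push_cast
    rw [map_mul]

/-- `4 = 2²` in the parameter slot of Ireland–Rosen's character of `y² = x³ + 1` (`k = 1`, `D = 4k`). [folklore] -/
theorem four_eq : ((4 * (1 : ℤ) : ℤ) : 𝓞 K3) = ((2 : ℤ) : 𝓞 K3) ^ (1 + 1) := by push_cast; norm_num

/-- **`ν₄(𝔞) = e(χ_{(2)}(ϖ_𝔞))²`** for `𝔞` prime to `6` (`ν₄ = ν₂²` and §1). [cite: IrelandRosen1990, Ch. 9 §3 Prop. 9.3.3, Ch. 18 §7] -/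
theorem grossenNu_four {v₂ : HeightOneSpectrum (𝓞 K3)} (hv : ((2 : ℤ) : 𝓞 K3) ∈ v₂.asIdeal) (I : Ideal (𝓞 K3))
    (h : Adm ((2 : ℤ) : 𝓞 K3) I) :
    grossenNu ((4 * (1 : ℤ) : ℤ) : 𝓞 K3) 1 0 I = (embC ((cubicResidueSymbol v₂ (Ideal.Quotient.mk v₂.asIdeal (primGen I)) : 𝓞 K3) : K3)) ^ 2 := by
  rw [four_eq, grossenNu_pow_left _ I h 1, grossenNu_apply, if_pos h, psi_two_eq_cubicResidueSymbol_primGen hv I h]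
  simp only [pow_one, PlaneLattice.sectorWeight, pow_zero, mul_one]

/-! ## §2 The two primary generators: `ϖ′ = χ_{(2)}(ϖ)² ϖ` is the generator `≡ 1 (mod 2λ)` -/

/-- `6 ∈ 2λ`. [folklore] -/
theorem six_mem_span : (3 : 𝓞 K3) * ((2 : ℤ) : 𝓞 K3) ∈ Ideal.span {mkInt 2 (-2)} := by
  rw [show (3 : 𝓞 K3) * ((2 : ℤ) : 𝓞 K3) = mkInt 6 0 by rw [mkInt_intCast]; push_cast; norm_num, mem_span_iff]; omega

/-- An ideal prime to `6` is prime to `2λ`. [folklore] -/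
theorem isCoprime_span_of_adm {I : Ideal (𝓞 K3)} (h : Adm ((2 : ℤ) : 𝓞 K3) I) : IsCoprime I (Ideal.span {mkInt 2 (-2)}) :=
  isCoprime_of_le h.2 ((Ideal.span_singleton_le_iff_mem _).mpr six_mem_span)

/-- The primary generator of an ideal prime to `6` is not divisible by `2`. [folklore] -/
theorem primGen_not_mem {I : Ideal (𝓞 K3)} (h : Adm ((2 : ℤ) : 𝓞 K3) I) {v₂ : HeightOneSpectrum (𝓞 K3)}
    (hv : ((2 : ℤ) : 𝓞 K3) ∈ v₂.asIdeal) : primGen I ∉ v₂.asIdeal := by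
  intro hmem
  have hI : I ≤ v₂.asIdeal := by
    rw [← span_primGen h.coprime_three]; exact (Ideal.span_singleton_le_iff_mem _).mpr hmem
  have h6 : Ideal.span {3 * ((2 : ℤ) : 𝓞 K3)} ≤ v₂.asIdeal :=
    (Ideal.span_singleton_le_iff_mem _).mpr (Ideal.mul_mem_left _ _ hv)
  have hsup := Ideal.isCoprime_iff_sup_eq.mp h.2
  exact v₂.isPrime.ne_top (top_le_iff.mp (hsup ▸ sup_le hI h6))

/-- `a + bω ∈ (2) ⟺ 2 ∣ a ∧ 2 ∣ b`. [folklore] -/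
theorem mem_span_two_iff (a b : ℤ) : mkInt a b ∈ Ideal.span {((2 : ℤ) : 𝓞 K3)} ↔ 2 ∣ a ∧ 2 ∣ b := by
  rw [← mkInt_intCast, Ideal.mem_span_singleton]
  constructor
  · rintro ⟨y, hy⟩
    obtain ⟨c, d, rfl⟩ := exists_eq_mkInt y
    rw [mkInt_mul, mkInt_inj] at hy
    omega
  · rintro ⟨⟨a', ha⟩, ⟨b', hb⟩⟩
    exact ⟨mkInt a' b', by rw [mkInt_mul, mkInt_inj]; omega⟩

/-- `a + bω ∈ (λ) = (1 − ω) ⟺ 3 ∣ a + b` (reduction modulo `λ`: `ω ↦ 1`). [cite: IrelandRosen1990, Ch. 9 §1] -/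
theorem mem_span_lam_iff (a b : ℤ) : mkInt a b ∈ Ideal.span {mkInt 1 (-1)} ↔ 3 ∣ a + b := by
  rw [Ideal.mem_span_singleton]
  constructor
  · rintro ⟨y, hy⟩
    obtain ⟨c, d, rfl⟩ := exists_eq_mkInt y
    rw [mkInt_mul, mkInt_inj] at hy
    omega
  · rintro ⟨e, he⟩
    exact ⟨mkInt (a - e) e, by rw [mkInt_mul, mkInt_inj]; omega⟩

/-- `(2) ∩ (λ) ⊆ 2λ`. [folklore] -/
theorem mem_span_of_mem_two_of_mem_lam {x : 𝓞 K3} (h2 : x ∈ Ideal.span {((2 : ℤ) : 𝓞 K3)})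
    (hl : x ∈ Ideal.span {mkInt 1 (-1)}) : x ∈ Ideal.span {mkInt 2 (-2)} := by
  obtain ⟨a, b, rfl⟩ := exists_eq_mkInt x
  rw [mem_span_two_iff] at h2
  rw [mem_span_lam_iff] at hl
  rw [mem_span_iff]
  omega

/-- `1 − ω = mkInt 1 (−1)` and `3 ∈ (λ)`, `ω^j − 1 ∈ (λ)`: the pieces of `χ²ϖ − 1 ∈ (λ)`. [cite: IrelandRosen1990, Ch. 9 §1] -/
theorem one_sub_zetaInt_eq : (1 : 𝓞 K3) - zetaInt = mkInt 1 (-1) := by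
  rw [zetaInt_eq, show (1 : 𝓞 K3) = mkInt 1 0 by rw [mkInt_intCast, Int.cast_one], sub_eq_iff_eq_add, mkInt_add]
  norm_num

/-- `x ≡ 1 (mod 3)` implies `x ≡ 1 (mod λ)`. [cite: IrelandRosen1990, Ch. 9 §1] -/
theorem mem_span_lam_of_mem_three {x : 𝓞 K3} (hx : x - 1 ∈ three) : x - 1 ∈ Ideal.span {mkInt 1 (-1)} := by
  rw [Ideal.mem_span_singleton] at hx ⊢
  refine dvd_trans ⟨mkInt 2 1, ?_⟩ hx
  rw [mkInt_mul, show (3 : 𝓞 K3) = mkInt 3 0 by rw [mkInt_intCast]; norm_cast]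
  norm_num

/-- A cube root of unity is `≡ 1 (mod λ)`. [cite: IrelandRosen1990, Ch. 9 §1] -/
theorem pow_sub_one_mem_span_lam {μ : 𝓞 K3} (hμ : μ ^ 3 = 1) (n : ℕ) : μ ^ n - 1 ∈ Ideal.span {mkInt 1 (-1)} := by
  obtain ⟨i, -, rfl⟩ := EisensteinGrossen.hζ.eq_pow_of_pow_eq_one hμ
  rw [← pow_mul, Ideal.mem_span_singleton, ← one_sub_zetaInt_eq]
  have h := sub_dvd_pow_sub_pow (1 : 𝓞 K3) zetaInt (i * n)
  rw [one_pow] at h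
  rwa [← dvd_neg, neg_sub]

/-- ★ **The generator `≡ 1 (mod 2λ)` of an ideal prime to `6` is `χ_{(2)}(ϖ)² · ϖ`**, `ϖ ≡ 1 (mod 3)` its primary generator
(`χ_{(2)}(ϖ) ≡ ϖ (mod 2)`, `ϖ³ ≡ 1 (mod 2)`; `χ² ≡ 1`, `ϖ ≡ 1 (mod λ)`). [cite: IrelandRosen1990, Ch. 9 §3 Prop. 9.3.3–9.3.5] -/
theorem primarize_primGen {I : Ideal (𝓞 K3)} (h : Adm ((2 : ℤ) : 𝓞 K3) I) {v₂ : HeightOneSpectrum (𝓞 K3)}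
    (hv : ((2 : ℤ) : 𝓞 K3) ∈ v₂.asIdeal) :
    primarize hsurj36 (primGen I) =
      cubicResidueSymbol v₂ (Ideal.Quotient.mk v₂.asIdeal (primGen I)) ^ 2 * primGen I := by
  set ϖ := primGen I with hϖ
  set χ := cubicResidueSymbol v₂ (Ideal.Quotient.mk v₂.asIdeal ϖ) with hχdef
  have h3 := three_not_mem_of_two_mem hv
  have hϖv : ϖ ∉ v₂.asIdeal := primGen_not_mem h hv
  have hϖ0 : Ideal.Quotient.mk v₂.asIdeal ϖ ≠ 0 := fun h0 ↦ hϖv (Ideal.Quotient.eq_zero_iff_mem.mp h0)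
  obtain ⟨hχ3, hχ⟩ := cubicResidueSymbol_spec EisensteinGrossen.hζ h3 hϖ0
  have hfermat := pow_residueCard_sub_one_div_three_pow_three EisensteinGrossen.hζ h3 hϖ0
  rw [residueCard_eq_of_two_mem hv, show (2 ^ 2 - 1) / 3 = 1 from rfl, pow_one] at hχ hfermat
  have hχu : IsUnit χ := IsUnit.of_pow_eq_one hχ3 (by norm_num)
  have hspan : Ideal.span {ϖ} = I := span_primGen h.coprime_three
  refine primarize_eq_of hsurj36 hinj36 (by rw [hspan]; exact isCoprime_span_of_adm h)
    (Ideal.span_singleton_mul_left_unit (hχu.pow 2) ϖ) ?_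
  refine mem_span_of_mem_two_of_mem_lam ?_ ?_
  · -- modulo `(2)`: `χ²ϖ ≡ ϖ³ ≡ 1`
    have hv2 : v₂.asIdeal = Ideal.span {((2 : ℤ) : 𝓞 K3)} := by
      simpa using asIdeal_eq_of_mod_three_eq_two Nat.prime_two (by norm_num) v₂ hv
    rw [← hv2, ← Ideal.Quotient.eq, map_mul, map_pow, hχ, map_one, ← pow_succ]
    exact hfermat
  · -- modulo `λ`: `χ² ≡ 1`, `ϖ ≡ 1`
    have h1 : χ ^ 2 * (ϖ - 1) ∈ Ideal.span {mkInt 1 (-1)} :=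
      Ideal.mul_mem_left _ _ (mem_span_lam_of_mem_three (primGen_sub_one_mem h.coprime_three))
    have h2 := pow_sub_one_mem_span_lam hχ3 2
    have := Ideal.add_mem _ h1 h2
    rwa [show χ ^ 2 * (ϖ - 1) + (χ ^ 2 - 1) = χ ^ 2 * ϖ - 1 by ring] at this

/-! ## §3 The ray-class coefficient mod `2λ` is Ireland–Rosen's weight `ν₄(𝔞) e(ϖ_𝔞)` -/

/-- Prime to `2λ` implies prime to `(6)` and to `(12)` (`(2λ)(λ) = (6)`, `(2λ)² = (12)` up to units). [folklore] -/
theorem adm_of_isCoprime_span {I : Ideal (𝓞 K3)} (hI : I ≠ ⊥) (h : IsCoprime I (Ideal.span {mkInt 2 (-2)})) :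
    Adm ((2 : ℤ) : 𝓞 K3) I ∧ Adm ((4 * (1 : ℤ) : ℤ) : 𝓞 K3) I := by
  have hζu : IsUnit (zetaInt : 𝓞 K3) := EisensteinGrossen.hζ.isUnit (by norm_num)
  have hlam : IsCoprime I (Ideal.span {mkInt 1 (-1)}) :=
    isCoprime_of_le h (Ideal.span_singleton_le_span_singleton.mpr ⟨mkInt 2 0, by rw [mkInt_mul, mkInt_inj]; omega⟩)
  have e6 : Ideal.span {mkInt 2 (-2)} * Ideal.span {mkInt 1 (-1)} = Ideal.span {3 * ((2 : ℤ) : 𝓞 K3)} := by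
    rw [Ideal.span_singleton_mul_span_singleton, mkInt_mul]
    refine Ideal.span_singleton_eq_span_singleton.mpr ⟨-(hζu.unit ^ 2), ?_⟩
    rw [Units.val_neg, Units.val_pow_eq_pow_val, IsUnit.unit_spec, mul_neg, mul_comm, zetaInt_sq_mul_mkInt, neg_mkInt,
      show (3 : 𝓞 K3) * ((2 : ℤ) : 𝓞 K3) = mkInt 6 0 by rw [mkInt_intCast]; push_cast; norm_num, mkInt_inj]
    norm_num
  have e12 : Ideal.span {mkInt 2 (-2)} * Ideal.span {mkInt 2 (-2)} = Ideal.span {3 * ((4 * (1 : ℤ) : ℤ) : 𝓞 K3)} := by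
    rw [Ideal.span_singleton_mul_span_singleton, mkInt_mul]
    refine Ideal.span_singleton_eq_span_singleton.mpr ⟨-(hζu.unit ^ 2), ?_⟩
    rw [Units.val_neg, Units.val_pow_eq_pow_val, IsUnit.unit_spec, mul_neg, mul_comm, zetaInt_sq_mul_mkInt, neg_mkInt,
      show (3 : 𝓞 K3) * ((4 * (1 : ℤ) : ℤ) : 𝓞 K3) = mkInt 12 0 by rw [mkInt_intCast]; push_cast; norm_num, mkInt_inj]
    norm_num
  exact ⟨⟨hI, by rw [← e6]; exact IsCoprime.mul_right h hlam⟩, ⟨hI, by rw [← e12]; exact IsCoprime.mul_right h h⟩⟩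

/-- ★ **`rayClassCoeff (2λ) ψ 𝔞 = ν₄(𝔞) · e(ϖ_𝔞)` for every ideal `𝔞`** (both vanish off `(𝔞, 6) = 1`; on it, §2 and §1). [cite: IrelandRosen1990, Ch. 18 §7] -/
theorem rayClassCoeff_psi36 (I : Ideal (𝓞 K3)) :
    rayClassCoeff (Ideal.span {mkInt 2 (-2)}) (fun v ↦ (embC : K3 →ₐ[ℚ] ℂ).toRingHom (primaryGen hsurj36 v)) I =
      grossenNu ((4 * (1 : ℤ) : ℤ) : 𝓞 K3) 1 0 I * embC (primGen I : K3) := by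
  obtain ⟨v₂, hv⟩ := exists_two_mem
  unfold rayClassCoeff
  by_cases hc : I ≠ ⊥ ∧ IsCoprime I (Ideal.span {mkInt 2 (-2)})
  · obtain ⟨h2, h4⟩ := adm_of_isCoprime_span hc.1 hc.2
    rw [if_pos hc, grossenNu_four hv I h2]
    set ϖ := primGen I with hϖ
    have hI : Ideal.span {ϖ} = I := span_primGen h2.coprime_three
    have hϖ0 : ϖ ≠ 0 := primGen_ne_zero h2.coprime_three h2.1
    have hpow : idealPow K3 (fun v ↦ (embC : K3 →ₐ[ℚ] ℂ).toRingHom (primaryGen hsurj36 v)) I =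
        (embC : K3 →ₐ[ℚ] ℂ).toRingHom (primarize hsurj36 ϖ) := by
      rw [← hI]
      exact idealPow_primaryGen_span hsurj36 hinj36 span_ne_bot _ hϖ0 (by rw [hI]; exact hc.2)
    rw [hpow, primarize_primGen h2 hv, HeckeThetaTwentySeven.embC_toRingHom_apply]
    push_cast
    rw [map_mul, map_pow]
  · rw [if_neg hc, grossenNu_apply, if_neg, zero_mul]
    intro h4
    apply hc
    have h4' : Adm (((2 : ℤ) : 𝓞 K3) * ((2 : ℤ) : 𝓞 K3)) I := by
      have h := h4
      rw [four_eq, pow_succ, pow_one] at h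
      exact h
    obtain ⟨h2, -⟩ := adm_of_adm_mul_left h4'
    exact ⟨h2.1, isCoprime_span_of_adm h2⟩

/-- The ray-class coefficient sum IS Ireland–Rosen's Hecke sum `Σ_{N𝔞 = n} ν₄(𝔞) e(ϖ_𝔞)`. [cite: IrelandRosen1990, Ch. 18 §7] -/
theorem finsum_rayClassCoeff_eq_heckeSum36 (n : ℕ) :
    ∑ᶠ J ∈ {J : Ideal (𝓞 K3) | Ideal.absNorm J = n},
        rayClassCoeff (Ideal.span {mkInt 2 (-2)}) (fun v ↦ (embC : K3 →ₐ[ℚ] ℂ).toRingHom (primaryGen hsurj36 v)) J =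
      ∑ I ∈ idealsOfNorm K3 n, grossenNu ((4 * (1 : ℤ) : ℤ) : 𝓞 K3) 1 0 I * embC (primGen I : K3) := by
  rw [finsum_mem_eq_finite_toFinset_sum _ (Ideal.finite_setOf_absNorm_eq n)]
  refine Finset.sum_congr (Finset.ext fun J ↦ ?_) fun J _ ↦ rayClassCoeff_psi36 J
  rw [Set.Finite.mem_toFinset, mem_idealsOfNorm, Set.mem_setOf_eq]

/-- **`aₙ(36a1) = Σ_{N𝔞 = n} ν₄(𝔞) e(ϖ_𝔞)`** (tree ★ `SexticTwist.lFunction_eq_jacobiSym_mul_sum` at `k = 1`: `y² = x³ + 1` is the Mordell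
curve `E¹`, sixth-power-free, not of the form `16u`). [cite: IrelandRosen1990, Ch. 18 §7] -/
theorem lFunction_thirtySixA1_eq_heckeSum (n : ℕ) :
    (((⟨0, 0, 0, 0, 1⟩ : WeierstrassCurve ℚ).LFunction n : ℤ) : ℂ) =
      ∑ I ∈ idealsOfNorm K3 n, grossenNu ((4 * (1 : ℤ) : ℤ) : 𝓞 K3) 1 0 I * embC (primGen I : K3) := by
  have h6 : ∀ q : ℕ, q.Prime → ¬ (q : ℤ) ^ 6 ∣ (1 : ℤ) := by
    intro q hq h
    have h2 : (2 : ℤ) ^ 6 ≤ (q : ℤ) ^ 6 := pow_le_pow_left₀ (by norm_num) (by exact_mod_cast hq.two_le) 6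
    have := Int.le_of_dvd (by norm_num) h
    omega
  have h16 : ¬ ∃ u : ℤ, u % 4 = 1 ∧ (1 : ℤ) = 16 * u := by rintro ⟨u, -, hu⟩; omega
  have h := lFunction_eq_jacobiSym_mul_sum (k := 1) one_ne_zero h6 h16 n
  simp only [jacobiSym.one_left, Int.cast_one, one_mul] at h
  rw [← h, mordellCurve_eq]

/-! ## §4 `36a1` is modular by a newform of level `36`; the newform IS `η(6τ)⁴` — FACT-FREE -/

/-- `a₁ = 1` for the Hecke sum (the unit ideal). [folklore] -/
theorem heckeSum36_one : ∑ I ∈ idealsOfNorm K3 1, grossenNu ((4 * (1 : ℤ) : ℤ) : 𝓞 K3) 1 0 I * embC (primGen I : K3) = 1 := by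
  rw [idealsOfNorm_one, Finset.sum_singleton, primGen_top, show (⊤ : Ideal (𝓞 K3)) = 1 from Ideal.one_eq_top.symm, map_one]
  simp

/-- **`36a1 : y² = x³ + 1` is modular by a newform of level `36` — FACT-FREE**: `∃ g ∈ S₂(Γ₀(36)), IsNewformOf 36a1 g` (Hecke's theta series mod
`2λ`; new since `S₂(Γ₀(M)) = 0` for `M ∣ 36` proper; eigen since `dim S₂(Γ₀(36)) = 1`; `a₁ = 1`; `aₙ(g) = aₙ(36a1)` by §3).
[cite: Hecke1926Modulfunktionen] [cite: IrelandRosen1990, Ch. 18 §7] -/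
theorem existsNewform_thirtySixA1 : ∃ g : CuspForm (Gamma0 36) 2, IsNewformOf (⟨0, 0, 0, 0, 1⟩ : WeierstrassCurve ℚ) g := by
  obtain ⟨g, hg⟩ := exists_heckeTheta_thirtySix
  have hg' : ∀ n, cuspCoeff g n = ∑ I ∈ idealsOfNorm K3 n, grossenNu ((4 * (1 : ℤ) : ℤ) : 𝓞 K3) 1 0 I * embC (primGen I : K3) :=
    fun n ↦ (hg n).trans (finsum_rayClassCoeff_eq_heckeSum36 n)
  have h1 : cuspCoeff g 1 = 1 := by rw [hg', heckeSum36_one]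
  have hne : g ≠ 0 := by
    intro h
    have h0 : cuspCoeff ((0 : ℂ) • g) 1 = 0 := by rw [cuspCoeff_smul, zero_mul]
    rw [zero_smul, ← h, h1] at h0
    exact one_ne_zero h0
  exact ⟨g, ⟨NewformThirtySix.mem_newSubspace0_thirtySix g, NewformThirtySix.isHeckeEigenform_of_ne_zero_thirtySix hne, h1⟩,
    fun n ↦ by rw [hg', lFunction_thirtySixA1_eq_heckeSum]⟩

/-- **`aₙ(η(6τ)⁴) = aₙ(y² = x³ + 1)` for ALL `n`, FACT-FREE** (the newform of §4 is a newform of level `36`, hence `η(6τ)⁴` by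
`NewformThirtySix.eq_etaProductThirtySix_of_isNewform0`). [cite: Koehler2011, §1] [cite: CremonaAlgorithms1997, Table 3 (N = 36)] -/
theorem cuspCoeff_etaProductThirtySix_eq_lFunction_thirtySixA1 (n : ℕ) :
    cuspCoeff cuspFormEtaProductThirtySix n = (((⟨0, 0, 0, 0, 1⟩ : WeierstrassCurve ℚ).LFunction n : ℤ) : ℂ) := by
  obtain ⟨g, hg⟩ := existsNewform_thirtySixA1
  rw [← NewformThirtySix.eq_etaProductThirtySix_of_isNewform0 hg.1]
  exact hg.2 n

/-- **`η(6τ)⁴` is the newform of `36a1 : y² = x³ + 1`** (`IsNewformOf`, FACT-FREE). [cite: Koehler2011, §1] [cite: CremonaAlgorithms1997, Table 1 (36a1)] -/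
theorem isNewformOf_thirtySixA1_etaProduct : IsNewformOf (⟨0, 0, 0, 0, 1⟩ : WeierstrassCurve ℚ) cuspFormEtaProductThirtySix :=
  NonVacuityThirtySix.isNewformOf_etaProductThirtySix_of_cuspCoeff_eq cuspCoeff_etaProductThirtySix_eq_lFunction_thirtySixA1

/-- **The classical identity `η(6τ)⁴ = Σ_{(𝔞,6)=1} ν₄(𝔞) ϖ_𝔞 q^{N𝔞}`** (the `η`-product is Hecke's theta series of `ℚ(ω)` mod `2λ`), coefficientwise,
FACT-FREE. [cite: Koehler2011, §1] [cite: Hecke1926Modulfunktionen] -/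
theorem cuspCoeff_etaProductThirtySix_eq_heckeSum (n : ℕ) :
    cuspCoeff cuspFormEtaProductThirtySix n = ∑ I ∈ idealsOfNorm K3 n, grossenNu ((4 * (1 : ℤ) : ℤ) : 𝓞 K3) 1 0 I * embC (primGen I : K3) := by
  rw [cuspCoeff_etaProductThirtySix_eq_lFunction_thirtySixA1, lFunction_thirtySixA1_eq_heckeSum]

/-- **BCDT-modularity of `36a1` at its conductor level, unconditionally**: for `M = N(36a1)` (`= 36`, kernel certificate
`NonVacuityThirtySix.conductorNorm_thirtySixA1`) there is a newform of `36a1` in `S₂(Γ₀(M))`. [cite: CremonaAlgorithms1997, Table 1 (36a1)] -/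
theorem exists_isNewformOf_thirtySixA1 (M : ℕ) [NeZero M] (hM : (⟨0, 0, 0, 0, 1⟩ : WeierstrassCurve ℚ).conductorNorm ℤ = M) :
    ∃ f : CuspForm (Gamma0 M) 2, IsNewformOf (⟨0, 0, 0, 0, 1⟩ : WeierstrassCurve ℚ) f := by
  have h36 : M = 36 := by rw [← hM, NonVacuityThirtySix.conductorNorm_thirtySixA1]
  subst h36
  exact ⟨_, isNewformOf_thirtySixA1_etaProduct⟩

/-! ## §5 THE WITNESS: the `X₀(36)`-domain of C2 and C3 is inhabited UNCONDITIONALLY, and `|c| = 1` on it -/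

/-- **A lattice-optimal `X₀(36)`-datum of a global minimal curve in the isogeny class `36a` EXISTS, with newform `η(6τ)⁴` and `|c| = 1`** —
FACT-FREE (p2 g26's plug `NonVacuityThirtySix.exists_latticeOptimalDatum_thirtySix_of_cuspCoeff_eq`, discharged by §4).
[cite: Hecke1926Modulfunktionen] [cite: EdixhovenManin1991, Prop. 2] -/
theorem exists_latticeOptimalDatum_thirtySix :
    ∃ (W₀ : WeierstrassCurve ℚ) (_ : W₀.IsElliptic) (_ : W₀.IsGloballyMinimal) (D₀ : ModularParametrizationData W₀ 36),
      D₀.f = cuspFormEtaProductThirtySix ∧ (⟨0, 0, 0, 0, 1⟩ : WeierstrassCurve ℚ).IsIsogenous W₀ ∧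
        (∀ z ∈ D₀.L.lattice, ∃ w ∈ periodLattice D₀.f, z = D₀.c * w) ∧ |D₀.maninConstant| = 1 := by
  haveI := NonVacuityThirtySix.isElliptic_thirtySixA1
  exact NonVacuityThirtySix.exists_latticeOptimalDatum_thirtySix_of_cuspCoeff_eq _ cuspCoeff_etaProductThirtySix_eq_lFunction_thirtySixA1

/-- **C2's AND C3's ∀-DOMAINS ARE INHABITED AT `N = 36 = 4·9`, UNCONDITIONALLY, and `|c| = 1`, `2 ∤ c`, `3 ∤ c` THERE**: the binder block
(globally minimal `W₀`, `X₀(36)`-datum with the lattice clause, `2² ∣ 36`, `3² ∣ 36`) is inhabited with no hypothesis, and every datum in it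
satisfies the conclusions of both cruxes (`LigozatIdentitiesThirtySix`).  The cruxes themselves (all levels) remain OPEN as filed.
[cite: Hecke1926Modulfunktionen] [cite: EdixhovenManin1991, Prop. 2] [cite: CremonaAlgorithms1997, Table 1 (36a1)] -/
theorem maninLocalTwoThree_domain_inhabited_thirtySix :
    (∃ (W₀ : WeierstrassCurve ℚ) (_ : W₀.IsElliptic) (_ : W₀.IsGloballyMinimal) (D₀ : ModularParametrizationData W₀ 36),
      (∀ z ∈ D₀.L.lattice, ∃ w ∈ periodLattice D₀.f, z = D₀.c * w) ∧ 2 ^ 2 ∣ 36 ∧ 3 ^ 2 ∣ 36) ∧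
    ∀ (W : WeierstrassCurve ℚ) [W.IsGloballyMinimal] (D : ModularParametrizationData W 36),
      (∀ z ∈ D.L.lattice, ∃ w ∈ periodLattice D.f, z = D.c * w) →
        |D.maninConstant| = 1 ∧ ¬ (2 : ℤ) ∣ D.maninConstant ∧ ¬ (3 : ℤ) ∣ D.maninConstant := by
  refine ⟨?_, fun W _ D hopt ↦ ⟨LigozatIdentitiesThirtySix.abs_maninConstant_eq_one_thirtySix W D hopt,
    LigozatIdentitiesThirtySix.not_two_dvd_maninConstant_thirtySix W D hopt,
    LigozatIdentitiesThirtySix.not_three_dvd_maninConstant_thirtySix W D hopt⟩⟩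
  obtain ⟨W₀, h₀, hmin, D₀, -, -, hopt, -⟩ := exists_latticeOptimalDatum_thirtySix
  exact ⟨W₀, h₀, hmin, D₀, hopt, NonVacuityThirtySix.two_sq_dvd_thirtySix, NonVacuityThirtySix.three_sq_dvd_thirtySix⟩

end Summit.BirchSwinnertonDyer.BirchSwinnertonDyer.Theorems.ManinLocalTwoThree.HeckeThetaThirtySix

end
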